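import Literature.NumberTheory.Automorphic.AutomorphicQuotientKernelFibreSum
import Literature.NumberTheory.Automorphic.GLnAutomorphicUnfolding
import Literature.NumberTheory.Automorphic.GodementJacquetThetaSeries
import HarnessLib

/-!
# Unfolding coset sums over `Γ ⧸ Γ'` against a weight:
# `c ∫_G h w dν = κ ∫_X Σ_{q ∈ Γ ⧸ Γ'} h(x̃ q̃) W(x̃ q̃) dμ`, `W(y) = Σ_{γ' ∈ Γ'} ∫_{A_G} w(y a γ') da`
(Gelbart, *Automorphic forms on adele groups* (1975), §9.B: (9.40)–(9.45), Lemma 9.11, Lemma 9.13,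
Prop. 9.17 — the passages `∫_{Z_∞⁺ G_ℚ \ G_𝔸} Σ_{δ ∈ B_ℚ \ G_ℚ} φ(δ x) dx = ∫_{Z_∞⁺ B_ℚ \ G_𝔸} φ(x) dx`
and `… = ∫_{Z_∞⁺ A_ℚ \ G_𝔸} …` "applying the usual integration techniques"; Weil (1940) §9 and
Bourbaki, *Intégration* VII §2 for integration over quotients by means of weights)

Topic `NumberTheory/Automorphic`; theorems only (no definition, no named fact, no instance visible
to importers). Part of the inline (D-0026) decomposition of
`Literature.NumberTheory.Automorphic.jacquetLanglands_transfer_exists` (Gelbart Thm. 10.5 via the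
trace formula): the parabolic term of the `GL₂` trace formula
(`GL2TraceFormulaModParabolic`, `GL2ParabolicKernelBorel`) is an integral over the automorphic
quotient `X = G(𝔸_K) ⧸ A_G G(K)` of coset sums `Σ_{q ∈ G(K) ⧸ B(K)} h(x̃ q̃)`; its truncated pieces
(Gelbart's `I_r, I_s, J_r, J_s`) are evaluated or bounded after "unfolding" them to integrals over
the group `G(𝔸_K)`, where Iwasawa coordinates are available (`IwasawaHaarGL2KAN`). This file proves
the unfolding step once and for all, for an arbitrary adelic group datum `𝒢` (with `G(K)` countable,
`ι = toAdelic` injective, `L = A_G G(K)` closed, a Haar measure `ρ = κ • ((a, γ) ↦ a γ)_* (α ⊗ #)` on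
`L` as produced by `AdelicGroupData.exists_eq_smul_map_mul_prod_count`) and an arbitrary subgroup
`Γ' ≤ G(K)`, in `[0, ∞]` and WITHOUT constructing an invariant measure on `G(𝔸_K) ⧸ A_G Γ'`:
instead of a fundamental domain one integrates against an arbitrary measurable **weight**
`w ≥ 0` on `G(𝔸_K)`, whose fibre functional along `A_G ι(Γ')`,

  `W(y) = Σ'_{γ' ∈ Γ'} ∫⁻_{A_G} w(y a ι(γ')) dα(a)`,

appears on the quotient side (the device of `Literature.MeasureTheory.Group.CoveringWeights`, here
for the non-discrete group `A_G ι(Γ')`):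

* `AdelicGroupData.lintegral_quotientSubgroup_eq_mul_lintegral_tsum` — `∫⁻_L F dρ =
  κ ∫⁻_{A_G} Σ'_{γ ∈ G(K)} F(a γ) dα` (the `[0, ∞]` form of the product decomposition; the Bochner
  form is `integral_quotientSubgroup_eq_smul_integral_tsum`).
* `AdelicGroupData.tsum_arithmeticSubgroup_eq_tsum_quotient_tsum` — `Σ'_{γ ∈ G(K)} F(γ) =
  Σ'_{q ∈ G(K) ⧸ Γ'} Σ'_{γ' ∈ Γ'} F(ι(q̃ γ'))` (`q̃ = q.out`).
* `AdelicGroupData.fiberLIntegral_mul_mk_eq_mul_tsum_quotient` — **the fibre integral of `h · w`**: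
  for measurable `h, w ≥ 0` with `h` right invariant under `ι(Γ')` and under `A_G`,
  `∫⁻_L (h w)(g ℓ) dρ(ℓ) = κ Σ'_{q} h(g ι(q̃)) W(g ι(q̃))`.
* `AdelicGroupData.mul_lintegral_tsum_quotient_mul_eq` — **the unfolding identity**: for an
  automorphic measure `μ` on `X` and a Haar measure `ν` on `G(𝔸_K)`,

    `κ ∫⁻_X Σ'_{q ∈ G(K) ⧸ Γ'} h(x̃ ι(q̃)) W(x̃ ι(q̃)) dμ(x) = c ∫⁻_{G(𝔸_K)} h w dν`,

  `c = unfoldingConstant L ρ μ ν` (Weil's formula for the closed subgroup `L`,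
  `Literature.MeasureTheory.Group.InvariantQuotientUnfolding`, applied to `h w`).
* `AdelicGroupData.mul_lintegral_tsum_quotient_le` — **domination**: if `m ≤ W` on `{h ≠ 0}` then
  `κ m ∫⁻_X Σ'_q h(x̃ ι(q̃)) dμ ≤ c ∫⁻ h w dν` (a set `T` with `w = 1_T` meeting every coset of
  `A_G ι(Γ')` issued from `{h ≠ 0}` in measure `≥ m` dominates the quotient integral — the shape of
  Gelbart's estimates (9.44)–(9.46) for `J_r + J_s` over the cusp);
  `AdelicGroupData.mul_lintegral_tsum_quotient_eq` — **exact unfolding**: if `W = m` on `{h ≠ 0}`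
  then equality (a weight of constant mass, e.g. the indicator of a fundamental domain — the shape
  of (9.47)–(9.48) and of the computation of `I_s`, p. 134).
* `GLn.…` — the case `G = GL_n`: `ι` is injective (`toAdelic_gl_injective`), `G(K)` countable,
  `L` closed, `ρ = quotientSubgroupHaar`, `c = automorphicUnfoldingConstant`.

## References

* S. Gelbart, *Automorphic forms on adele groups*, Ann. of Math. Studies 83 (1975), §9.B,
  (9.40)–(9.48), Lemma 9.11, Lemma 9.13, Prop. 9.17 [Gelbart1975].
* H. Jacquet, R. P. Langlands, *Automorphic forms on `GL(2)`*, LNM 114 (1970), §16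
  [JacquetLanglands1970].
* J. R. Getz, H. Hahn, *An Introduction to Automorphic Representations* (2024), Thm. 3.2.2
  [GetzHahn2024].
-/

noncomputable section

open MeasureTheory Measure Set Filter Topology IsDedekindDomain NumberField
open Literature.MeasureTheory.Group
open scoped ENNReal NNReal

namespace Literature.NumberTheory.Automorphic

-- the quotient carries the tree's Borel σ-algebra, not Mathlib's quotient σ-algebra
attribute [-instance] Quotient.instMeasurableSpace QuotientGroup.measurableSpace

namespace AdelicGroupData

universe u

variable {K : Type} [Field K] [NumberField K] (𝒢 : AdelicGroupData.{u} K)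

attribute [local instance] measurableSpaceQuotientForm borelSpaceQuotientForm

/-! ### Reindexing `G(K)` by `(G(K) ⧸ Γ') × Γ'` -/

section Reindex

variable (Γ' : Subgroup 𝒢.Rational)

/-- `(q, γ') ↦ q̃ γ'` is a bijection `(G(K) ⧸ Γ') × Γ' → G(K)` (`q̃ = q.out`). [folklore] -/
theorem bijective_quotient_out_mul :
    Function.Bijective fun p : (𝒢.Rational ⧸ Γ') × Γ' => p.1.out * (p.2 : 𝒢.Rational) := by
  constructor
  · rintro ⟨q₁, γ₁⟩ ⟨q₂, γ₂⟩ h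
    dsimp only at h
    have hq : q₁ = q₂ := by
      have h1 : (QuotientGroup.mk (q₁.out * (γ₁ : 𝒢.Rational)) : 𝒢.Rational ⧸ Γ') =
          QuotientGroup.mk (q₂.out * (γ₂ : 𝒢.Rational)) := by rw [h]
      rwa [QuotientGroup.mk_mul_of_mem _ γ₁.2, QuotientGroup.mk_mul_of_mem _ γ₂.2,
        QuotientGroup.out_eq', QuotientGroup.out_eq'] at h1
    subst hq
    have hγ : (γ₁ : 𝒢.Rational) = γ₂ := mul_left_cancel h
    rw [Subtype.ext hγ]
  · intro r
    obtain ⟨γ, hγ⟩ := QuotientGroup.mk_out_eq_mul Γ' r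
    refine ⟨(QuotientGroup.mk r, γ⁻¹), ?_⟩
    dsimp only
    rw [hγ, Subgroup.coe_inv, mul_inv_cancel_right]

/-- **`Σ'_{γ ∈ G(K)} F(γ) = Σ'_{q ∈ G(K) ⧸ Γ'} Σ'_{γ' ∈ Γ'} F(ι(q̃ γ'))`** in `[0, ∞]`, for `ι`
injective (`G(K) ≅ ι(G(K))`, `G(K) ≅ (G(K) ⧸ Γ') × Γ'`). [folklore] -/
theorem tsum_arithmeticSubgroup_eq_tsum_quotient_tsum (hinj : Function.Injective 𝒢.toAdelic)
    (F : 𝒢.Adelic → ℝ≥0∞) :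
    ∑' γ : 𝒢.arithmeticSubgroup, F γ =
      ∑' q : 𝒢.Rational ⧸ Γ', ∑' γ' : Γ', F (𝒢.toAdelic (q.out * (γ' : 𝒢.Rational))) := by
  let e₁ : 𝒢.Rational ≃ 𝒢.arithmeticSubgroup := (MonoidHom.ofInjective hinj).toEquiv
  have he₁ : ∀ r, ((e₁ r : 𝒢.arithmeticSubgroup) : 𝒢.Adelic) = 𝒢.toAdelic r := fun r => rfl
  let e₂ : (𝒢.Rational ⧸ Γ') × Γ' ≃ 𝒢.Rational :=
    Equiv.ofBijective _ (bijective_quotient_out_mul 𝒢 Γ')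
  have he₂ : ∀ p, e₂ p = p.1.out * (p.2 : 𝒢.Rational) := fun p => rfl
  calc ∑' γ : 𝒢.arithmeticSubgroup, F γ
      = ∑' r : 𝒢.Rational, F (e₁ r) := (e₁.tsum_eq fun γ => F γ).symm
    _ = ∑' r : 𝒢.Rational, F (𝒢.toAdelic r) := tsum_congr fun r => by rw [he₁]
    _ = ∑' p : (𝒢.Rational ⧸ Γ') × Γ', F (𝒢.toAdelic (e₂ p)) :=
        (e₂.tsum_eq fun r => F (𝒢.toAdelic r)).symm
    _ = ∑' q : 𝒢.Rational ⧸ Γ', ∑' γ' : Γ', F (𝒢.toAdelic (q.out * (γ' : 𝒢.Rational))) := by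
        simp only [he₂]
        exact ENNReal.tsum_prod'

end Reindex

/-! ### The fibre integral of `h · w` along `L = A_G G(K)` -/

section Fibre

variable [MeasurableSpace 𝒢.Adelic] [BorelSpace 𝒢.Adelic] [SecondCountableTopology 𝒢.Adelic]
  [T2Space 𝒢.Adelic] [Countable 𝒢.arithmeticSubgroup]
  (α : Measure 𝒢.center')
  (ρ : Measure 𝒢.quotientSubgroup) {κ : ℝ≥0}
  (hκ : ρ = κ • Measure.map (fun p : 𝒢.center' × 𝒢.arithmeticSubgroup =>
      (⟨(p.1 : 𝒢.Adelic) * p.2, mulMap_mem 𝒢 p⟩ : 𝒢.quotientSubgroup)) (α.prod count))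

include hκ in
/-- **`∫⁻_L F dρ = κ ∫⁻_{A_G} Σ'_{γ ∈ G(K)} F(a γ) dα(a)`** for measurable `F ≥ 0` on
`L = A_G G(K)`, when `ρ = κ • ((a, γ) ↦ a γ)_* (α ⊗ counting)` (the `[0, ∞]` form of
`integral_quotientSubgroup_eq_smul_integral_tsum`; Tonelli for `α ⊗ counting`). [folklore] -/
theorem lintegral_quotientSubgroup_eq_mul_lintegral_tsum {F : 𝒢.quotientSubgroup → ℝ≥0∞}
    (hF : Measurable F) :
    ∫⁻ ℓ, F ℓ ∂ρ = κ * ∫⁻ a, ∑' γ : 𝒢.arithmeticSubgroup,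
      F ⟨(a : 𝒢.Adelic) * γ, mulMap_mem 𝒢 (a, γ)⟩ ∂α := by
  haveI : SecondCountableTopology 𝒢.center' := TopologicalSpace.Subtype.secondCountableTopology _
  haveI : SecondCountableTopology 𝒢.arithmeticSubgroup :=
    TopologicalSpace.Subtype.secondCountableTopology _
  haveI : BorelSpace 𝒢.arithmeticSubgroup := Subtype.borelSpace _
  haveI : MeasurableSingletonClass 𝒢.arithmeticSubgroup := inferInstance
  haveI : BorelSpace (𝒢.center' × 𝒢.arithmeticSubgroup) := Prod.borelSpace
  have hm : Measurable fun p : 𝒢.center' × 𝒢.arithmeticSubgroup =>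
      (⟨(p.1 : 𝒢.Adelic) * p.2, mulMap_mem 𝒢 p⟩ : 𝒢.quotientSubgroup) := by
    refine (Continuous.subtype_mk ?_ _).measurable
    exact (continuous_subtype_val.comp continuous_fst).mul
      (continuous_subtype_val.comp continuous_snd)
  have hprod := lintegral_prod (μ := α) (ν := (count : Measure 𝒢.arithmeticSubgroup))
    (fun p : 𝒢.center' × 𝒢.arithmeticSubgroup =>
      F ⟨(p.1 : 𝒢.Adelic) * p.2, mulMap_mem 𝒢 p⟩) (hF.comp hm).aemeasurable
  rw [hκ, lintegral_smul_measure, lintegral_map hF hm, hprod, ENNReal.smul_def, smul_eq_mul]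
  congr 1
  refine lintegral_congr fun a => ?_
  rw [lintegral_count]

variable (Γ' : Subgroup 𝒢.Rational)

include hκ in
/-- **The fibre integral of `h · w` along `L = A_G G(K)` as a coset sum**: for measurable
`h, w ≥ 0` on `G(𝔸_K)` with `h` right invariant under `ι(Γ')` and under `A_G`, and every `g`,

  `∫⁻_L h(g ℓ) w(g ℓ) dρ(ℓ) = κ Σ'_{q ∈ G(K) ⧸ Γ'} h(g ι(q̃)) · Σ'_{γ' ∈ Γ'} ∫⁻_{A_G} w(g ι(q̃) a ι(γ')) dα`

(product decomposition of `ρ`, `A_G` central, Tonelli, and the reindexing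
`G(K) = ⊔_q q̃ Γ'`). [cite: Gelbart1975, §9.B (9.44)] -/
theorem fiberLIntegral_mul_mk_eq_mul_tsum_quotient [ρ.IsMulLeftInvariant]
    (hinj : Function.Injective 𝒢.toAdelic)
    {h w : 𝒢.Adelic → ℝ≥0∞} (hh : Measurable h) (hw : Measurable w)
    (hhΓ : ∀ (g : 𝒢.Adelic) (γ : Γ'), h (g * 𝒢.toAdelic (γ : 𝒢.Rational)) = h g)
    (hhA : ∀ (g : 𝒢.Adelic) (a : 𝒢.center'), h (g * a) = h g) (g : 𝒢.Adelic) :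
    fiberLIntegral 𝒢.quotientSubgroup ρ (fun y => h y * w y) (QuotientGroup.mk g) =
      κ * ∑' q : 𝒢.Rational ⧸ Γ', h (g * 𝒢.toAdelic q.out) *
        ∑' γ' : Γ', ∫⁻ a : 𝒢.center',
          w (g * 𝒢.toAdelic q.out * a * 𝒢.toAdelic (γ' : 𝒢.Rational)) ∂α := by
  have hmul : Measurable fun y : 𝒢.Adelic => h y * w y := hh.mul hw
  have hF : Measurable fun ℓ : 𝒢.quotientSubgroup => h (g * ℓ) * w (g * ℓ) :=
    hmul.comp (measurable_const.mul measurable_subtype_coe)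
  have hA0 := lintegral_quotientSubgroup_eq_mul_lintegral_tsum 𝒢 α ρ hκ hF
  rw [fiberLIntegral_mk]
  beta_reduce at hA0 ⊢
  rw [hA0]
  congr 1
  -- `A_G` is central and `h` is `A_G`-invariant: `h(g (a γ)) = h(g γ)`
  have hc : ∀ (a : 𝒢.center') (x : 𝒢.Adelic), (a : 𝒢.Adelic) * x = x * a := fun a x =>
    ((Subgroup.mem_center_iff.1 (𝒢.center'_le a.2)) x).symm
  have h1 : ∀ (a : 𝒢.center') (γ : 𝒢.arithmeticSubgroup),
      h (g * ((a : 𝒢.Adelic) * γ)) = h (g * γ) := by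
    intro a γ
    rw [hc a, ← mul_assoc, hhA]
  simp only [h1]
  -- Tonelli: `∫⁻ Σ' = Σ' ∫⁻`, and pull the constant `h(g γ)` out of the integral over `A_G`
  have hwm : ∀ γ : 𝒢.arithmeticSubgroup,
      Measurable fun a : 𝒢.center' => w (g * ((a : 𝒢.Adelic) * γ)) := fun γ =>
    hw.comp (measurable_const.mul (measurable_subtype_coe.mul measurable_const))
  rw [lintegral_tsum fun γ => ((hwm γ).const_mul _).aemeasurable]
  have h2 : ∀ γ : 𝒢.arithmeticSubgroup,
      ∫⁻ a : 𝒢.center', h (g * γ) * w (g * ((a : 𝒢.Adelic) * γ)) ∂α =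
        h (g * γ) * ∫⁻ a : 𝒢.center', w (g * ((a : 𝒢.Adelic) * γ)) ∂α := fun γ =>
    lintegral_const_mul _ (hwm γ)
  simp only [h2]
  -- reindex `G(K)` by `(G(K) ⧸ Γ') × Γ'`
  have hre := tsum_arithmeticSubgroup_eq_tsum_quotient_tsum 𝒢 Γ' hinj
    (fun y => h (g * y) * ∫⁻ a : 𝒢.center', w (g * ((a : 𝒢.Adelic) * y)) ∂α)
  beta_reduce at hre
  rw [hre]
  refine tsum_congr fun q => ?_
  rw [← ENNReal.tsum_mul_left]
  refine tsum_congr fun γ' => ?_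
  have e1 : h (g * 𝒢.toAdelic (q.out * (γ' : 𝒢.Rational))) = h (g * 𝒢.toAdelic q.out) := by
    rw [map_mul, ← mul_assoc, hhΓ]
  have e2 : ∀ a : 𝒢.center',
      w (g * ((a : 𝒢.Adelic) * 𝒢.toAdelic (q.out * (γ' : 𝒢.Rational)))) =
        w (g * 𝒢.toAdelic q.out * a * 𝒢.toAdelic (γ' : 𝒢.Rational)) := by
    intro a
    rw [map_mul, ← mul_assoc (a : 𝒢.Adelic) (𝒢.toAdelic q.out), hc a (𝒢.toAdelic q.out)]
    simp only [mul_assoc]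
  simp only [e1, e2]

end Fibre

/-! ### The unfolding identity and its two uses -/

section Unfolding

variable [MeasurableSpace 𝒢.Adelic] [BorelSpace 𝒢.Adelic] [LocallyCompactSpace 𝒢.Adelic]
  [SecondCountableTopology 𝒢.Adelic] [T2Space 𝒢.Adelic] [Countable 𝒢.arithmeticSubgroup]
  [hL : IsClosed (𝒢.quotientSubgroup : Set 𝒢.Adelic)]
  (μ : Measure (𝒢.Adelic ⧸ 𝒢.quotientSubgroup))
  [SMulInvariantMeasure 𝒢.Adelic (𝒢.Adelic ⧸ 𝒢.quotientSubgroup) μ] [IsFiniteMeasureOnCompacts μ]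
  (α : Measure 𝒢.center')
  (ρ : Measure 𝒢.quotientSubgroup) [ρ.IsMulLeftInvariant] [IsFiniteMeasureOnCompacts ρ] [SFinite ρ]
  {κ : ℝ≥0}
  (hκ : ρ = κ • Measure.map (fun p : 𝒢.center' × 𝒢.arithmeticSubgroup =>
      (⟨(p.1 : 𝒢.Adelic) * p.2, mulMap_mem 𝒢 p⟩ : 𝒢.quotientSubgroup)) (α.prod count))
  (ν : Measure 𝒢.Adelic) [IsHaarMeasure ν]
  (Γ' : Subgroup 𝒢.Rational) (hinj : Function.Injective 𝒢.toAdelic)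
  {h w : 𝒢.Adelic → ℝ≥0∞} (hh : Measurable h) (hw : Measurable w)
  (hhΓ : ∀ (g : 𝒢.Adelic) (γ : Γ'), h (g * 𝒢.toAdelic (γ : 𝒢.Rational)) = h g)
  (hhA : ∀ (g : 𝒢.Adelic) (a : 𝒢.center'), h (g * a) = h g)

include hκ hinj hh hw hhΓ hhA in
/-- **Unfolding coset sums against a weight** (Gelbart (1975), §9.B, the step
`∫_{Z_∞⁺ G_ℚ \ G_𝔸} Σ_{δ ∈ B_ℚ \ G_ℚ} φ(δx) dx = ∫_{Z_∞⁺ B_ℚ \ G_𝔸} φ`, in weight form). For an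
adelic group datum with `G(K)` countable, `ι` injective, `L = A_G G(K)` closed and
`ρ = κ • ((a, γ) ↦ a γ)_* (α ⊗ #)`, an automorphic measure `μ` on `X = G(𝔸_K) ⧸ L`, a Haar
measure `ν` on `G(𝔸_K)`, a subgroup `Γ' ≤ G(K)` and measurable `h, w ≥ 0` on `G(𝔸_K)` with `h`
right invariant under `ι(Γ')` and `A_G` (here `μ` is any `G(𝔸_K)`-invariant measure on `X` finite
on compacta):

  `κ ∫⁻_X Σ'_{q ∈ G(K) ⧸ Γ'} h(x̃ ι(q̃)) W(x̃ ι(q̃)) dμ(x) = c ∫⁻_{G(𝔸_K)} h w dν`,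

`W(y) = Σ'_{γ' ∈ Γ'} ∫⁻_{A_G} w(y a ι(γ')) dα`, `x̃ = x.out`, `q̃ = q.out`,
`c = unfoldingConstant L ρ μ ν` (Weil's formula for `L ≤ G(𝔸_K)` applied to `h w`, and
`fiberLIntegral_mul_mk_eq_mul_tsum_quotient`). [cite: Gelbart1975, §9.B (9.44)] -/
theorem mul_lintegral_tsum_quotient_mul_eq :
    (κ : ℝ≥0∞) * ∫⁻ x, ∑' q : 𝒢.Rational ⧸ Γ',
        h ((x.out : 𝒢.Adelic) * 𝒢.toAdelic q.out) *
          ∑' γ' : Γ', ∫⁻ a : 𝒢.center',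
            w ((x.out : 𝒢.Adelic) * 𝒢.toAdelic q.out * a * 𝒢.toAdelic (γ' : 𝒢.Rational)) ∂α ∂μ =
      unfoldingConstant 𝒢.quotientSubgroup ρ μ ν * ∫⁻ g, h g * w g ∂ν := by
  calc (κ : ℝ≥0∞) * ∫⁻ x, ∑' q : 𝒢.Rational ⧸ Γ',
        h ((x.out : 𝒢.Adelic) * 𝒢.toAdelic q.out) *
          ∑' γ' : Γ', ∫⁻ a : 𝒢.center',
            w ((x.out : 𝒢.Adelic) * 𝒢.toAdelic q.out * a * 𝒢.toAdelic (γ' : 𝒢.Rational)) ∂α ∂μ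
      = ∫⁻ x, fiberLIntegral 𝒢.quotientSubgroup ρ (fun y => h y * w y) x ∂μ := by
        rw [← lintegral_const_mul' _ _ ENNReal.coe_ne_top]
        refine lintegral_congr fun x => ?_
        conv_rhs => rw [← QuotientGroup.out_eq' x]
        exact (fiberLIntegral_mul_mk_eq_mul_tsum_quotient 𝒢 α ρ hκ Γ' hinj hh hw hhΓ hhA _).symm
    _ = unfoldingConstant 𝒢.quotientSubgroup ρ μ ν * ∫⁻ g, h g * w g ∂ν :=
        lintegral_fiberLIntegral_eq_mul_lintegral 𝒢.quotientSubgroup ρ μ ν (hh.mul hw)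

include hκ hinj hh hw hhΓ hhA in
/-- **Domination of a coset-sum integral by a covering weight** (the shape of Gelbart (1975),
(9.44)–(9.46)): if `m ≤ W(y)` whenever `h(y) ≠ 0`, then

  `κ m ∫⁻_X Σ'_{q ∈ G(K) ⧸ Γ'} h(x̃ ι(q̃)) dμ(x) ≤ c ∫⁻_{G(𝔸_K)} h w dν`.

[cite: Gelbart1975, §9.B (9.44)–(9.46)] -/
theorem mul_lintegral_tsum_quotient_le (m : ℝ≥0∞)
    (hW : ∀ y, h y ≠ 0 → m ≤ ∑' γ' : Γ', ∫⁻ a : 𝒢.center',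
      w (y * a * 𝒢.toAdelic (γ' : 𝒢.Rational)) ∂α) :
    (κ : ℝ≥0∞) * m * ∫⁻ x, ∑' q : 𝒢.Rational ⧸ Γ',
        h ((x.out : 𝒢.Adelic) * 𝒢.toAdelic q.out) ∂μ ≤
      unfoldingConstant 𝒢.quotientSubgroup ρ μ ν * ∫⁻ g, h g * w g ∂ν := by
  rw [← mul_lintegral_tsum_quotient_mul_eq 𝒢 μ α ρ hκ ν Γ' hinj hh hw hhΓ hhA, mul_assoc]
  gcongr
  refine (lintegral_const_mul_le m _).trans (lintegral_mono fun x => ?_)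
  rw [← ENNReal.tsum_mul_left]
  refine ENNReal.tsum_le_tsum fun q => ?_
  by_cases h0 : h ((x.out : 𝒢.Adelic) * 𝒢.toAdelic q.out) = 0
  · simp [h0]
  · rw [mul_comm]
    gcongr
    exact hW _ h0

include hκ hinj hh hw hhΓ hhA in
/-- **Exact unfolding of a coset-sum integral by a weight of constant mass** (the shape of Gelbart
(1975), (9.47)–(9.48) and p. 134): if `W(y) = m` whenever `h(y) ≠ 0`, `m < ∞`, then

  `κ m ∫⁻_X Σ'_{q ∈ G(K) ⧸ Γ'} h(x̃ ι(q̃)) dμ(x) = c ∫⁻_{G(𝔸_K)} h w dν`.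

[cite: Gelbart1975, §9.B (9.47)–(9.48)] -/
theorem mul_lintegral_tsum_quotient_eq {m : ℝ≥0∞} (hm : m ≠ ∞)
    (hW : ∀ y, h y ≠ 0 → ∑' γ' : Γ', ∫⁻ a : 𝒢.center',
      w (y * a * 𝒢.toAdelic (γ' : 𝒢.Rational)) ∂α = m) :
    (κ : ℝ≥0∞) * m * ∫⁻ x, ∑' q : 𝒢.Rational ⧸ Γ',
        h ((x.out : 𝒢.Adelic) * 𝒢.toAdelic q.out) ∂μ =
      unfoldingConstant 𝒢.quotientSubgroup ρ μ ν * ∫⁻ g, h g * w g ∂ν := by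
  rw [← mul_lintegral_tsum_quotient_mul_eq 𝒢 μ α ρ hκ ν Γ' hinj hh hw hhΓ hhA, mul_assoc,
    ← lintegral_const_mul' _ _ hm]
  congr 1
  refine lintegral_congr fun x => ?_
  rw [← ENNReal.tsum_mul_left]
  refine tsum_congr fun q => ?_
  by_cases h0 : h ((x.out : 𝒢.Adelic) * 𝒢.toAdelic q.out) = 0
  · simp [h0]
  · rw [hW _ h0, mul_comm]

end Unfolding

end AdelicGroupData

/-! ### The case `G = GL_n` -/

section GLn

variable (n : ℕ) (K : Type) [Field K] [NumberField K]

attribute [local instance] adelicBorel borelSpace_adelic locallyCompactSpace_adelic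
  secondCountableTopology_gl_adelic

attribute [local instance] AdelicGroupData.measurableSpaceQuotientForm
  AdelicGroupData.borelSpaceQuotientForm

variable (μ : Measure ((AdelicGroupData.gl n K).Adelic ⧸ (AdelicGroupData.gl n K).quotientSubgroup))
  [SMulInvariantMeasure (AdelicGroupData.gl n K).Adelic
    ((AdelicGroupData.gl n K).Adelic ⧸ (AdelicGroupData.gl n K).quotientSubgroup) μ]
  [IsFiniteMeasureOnCompacts μ]
  (α : Measure (AdelicGroupData.gl n K).center') {κ : ℝ≥0}
  (hκ : quotientSubgroupHaar n K = κ • Measure.map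
    (fun p : (AdelicGroupData.gl n K).center' × (AdelicGroupData.gl n K).arithmeticSubgroup =>
      (⟨(p.1 : (AdelicGroupData.gl n K).Adelic) * p.2, AdelicGroupData.mulMap_mem _ p⟩ :
        (AdelicGroupData.gl n K).quotientSubgroup)) (α.prod count))
  (ν : Measure (AdelicGroupData.gl n K).Adelic) [IsHaarMeasure ν]
  (Γ' : Subgroup (GL (Fin n) K))
  {h w : (AdelicGroupData.gl n K).Adelic → ℝ≥0∞} (hh : Measurable h) (hw : Measurable w)
  (hhΓ : ∀ (g : (AdelicGroupData.gl n K).Adelic) (γ : Γ'),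
    h (g * (AdelicGroupData.gl n K).toAdelic (γ : GL (Fin n) K)) = h g)
  (hhA : ∀ (g : (AdelicGroupData.gl n K).Adelic) (a : (AdelicGroupData.gl n K).center'),
    h (g * a) = h g)

include hκ hh hw hhΓ hhA in
/-- **Unfolding coset sums against a weight on `GL_n`** (Gelbart (1975), §9.B (9.44)): for a
`GL_n(𝔸_K)`-invariant measure `μ` on `X = GL_n(𝔸_K) ⧸ A_G GL_n(K)` finite on compacta (e.g. an
automorphic measure), the Haar measure
`ρ_H = quotientSubgroupHaar = κ • ((a, γ) ↦ a γ)_* (α ⊗ #)` of `L = A_G GL_n(K)`, a Haar measure `ν`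
on `GL_n(𝔸_K)`, `Γ' ≤ GL_n(K)` and measurable `h, w ≥ 0` with `h` right invariant under `ι(Γ')` and
`A_G`:
`κ ∫⁻_X Σ'_{q ∈ GL_n(K) ⧸ Γ'} h(x̃ ι(q̃)) W(x̃ ι(q̃)) dμ = c ∫⁻ h w dν`,
`W(y) = Σ'_{γ'} ∫⁻_{A_G} w(y a ι(γ')) dα`, `c = unfoldingConstant L ρ_H μ ν` (which is
`automorphicUnfoldingConstant n K μ ν` for an automorphic measure `μ`).
[cite: Gelbart1975, §9.B (9.44)] -/
theorem GLn.mul_lintegral_tsum_quotient_mul_eq :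
    (κ : ℝ≥0∞) * ∫⁻ x, ∑' q : GL (Fin n) K ⧸ Γ',
        h ((x.out : (AdelicGroupData.gl n K).Adelic) * (AdelicGroupData.gl n K).toAdelic q.out) *
          ∑' γ' : Γ', ∫⁻ a : (AdelicGroupData.gl n K).center',
            w ((x.out : (AdelicGroupData.gl n K).Adelic) * (AdelicGroupData.gl n K).toAdelic q.out *
              a * (AdelicGroupData.gl n K).toAdelic (γ' : GL (Fin n) K)) ∂α ∂μ =
      unfoldingConstant (AdelicGroupData.gl n K).quotientSubgroup (quotientSubgroupHaar n K) μ ν *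
        ∫⁻ g, h g * w g ∂ν :=
  AdelicGroupData.mul_lintegral_tsum_quotient_mul_eq (AdelicGroupData.gl n K) μ α
    (quotientSubgroupHaar n K) hκ ν Γ' toAdelic_gl_injective hh hw hhΓ hhA

include hκ hh hw hhΓ hhA in
/-- **Domination by a covering weight on `GL_n`** (Gelbart (1975), (9.44)–(9.46)): if `m ≤ W(y)`
whenever `h(y) ≠ 0` then `κ m ∫⁻_X Σ'_q h(x̃ ι(q̃)) dμ ≤ c ∫⁻ h w dν`.
[cite: Gelbart1975, §9.B (9.44)–(9.46)] -/
theorem GLn.mul_lintegral_tsum_quotient_le (m : ℝ≥0∞)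
    (hW : ∀ y, h y ≠ 0 → m ≤ ∑' γ' : Γ', ∫⁻ a : (AdelicGroupData.gl n K).center',
      w (y * a * (AdelicGroupData.gl n K).toAdelic (γ' : GL (Fin n) K)) ∂α) :
    (κ : ℝ≥0∞) * m * ∫⁻ x, ∑' q : GL (Fin n) K ⧸ Γ',
        h ((x.out : (AdelicGroupData.gl n K).Adelic) * (AdelicGroupData.gl n K).toAdelic q.out) ∂μ ≤
      unfoldingConstant (AdelicGroupData.gl n K).quotientSubgroup (quotientSubgroupHaar n K) μ ν *
        ∫⁻ g, h g * w g ∂ν :=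
  AdelicGroupData.mul_lintegral_tsum_quotient_le (AdelicGroupData.gl n K) μ α
    (quotientSubgroupHaar n K) hκ ν Γ' toAdelic_gl_injective hh hw hhΓ hhA m hW

include hκ hh hw hhΓ hhA in
/-- **Exact unfolding by a weight of constant mass on `GL_n`** (Gelbart (1975), (9.47)–(9.48),
p. 134): if `W(y) = m < ∞` whenever `h(y) ≠ 0` then `κ m ∫⁻_X Σ'_q h(x̃ ι(q̃)) dμ = c ∫⁻ h w dν`.
[cite: Gelbart1975, §9.B (9.47)–(9.48)] -/
theorem GLn.mul_lintegral_tsum_quotient_eq {m : ℝ≥0∞} (hm : m ≠ ∞)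
    (hW : ∀ y, h y ≠ 0 → ∑' γ' : Γ', ∫⁻ a : (AdelicGroupData.gl n K).center',
      w (y * a * (AdelicGroupData.gl n K).toAdelic (γ' : GL (Fin n) K)) ∂α = m) :
    (κ : ℝ≥0∞) * m * ∫⁻ x, ∑' q : GL (Fin n) K ⧸ Γ',
        h ((x.out : (AdelicGroupData.gl n K).Adelic) * (AdelicGroupData.gl n K).toAdelic q.out) ∂μ =
      unfoldingConstant (AdelicGroupData.gl n K).quotientSubgroup (quotientSubgroupHaar n K) μ ν *
        ∫⁻ g, h g * w g ∂ν :=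
  AdelicGroupData.mul_lintegral_tsum_quotient_eq (AdelicGroupData.gl n K) μ α
    (quotientSubgroupHaar n K) hκ ν Γ' toAdelic_gl_injective hh hw hhΓ hhA hm hW

end GLn

end Literature.NumberTheory.Automorphic
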